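import Summits.Langlands.Langlands.Theses.EisensteinGelfandKirillov

/-!
# `EisensteinGelfandKirillov.SectorComplement` (stmt-Langlands-18275) — negative-side position lemmas

Disprover's kernel-checked bookkeeping for the route's declared complement
`SectorComplement := ReducibleCrystallineModular → Langlands` (D-0027 §2.2 frame item). Nothing here
asserts the item, its negation, the target or the summit; every conclusion is negative or a truth table:

* `eisensteinGelfandKirillov_not_sectorComplement_iff`: `¬ C ↔ X ∧ ¬ Langlands` — a disproof of the
  frame is exactly a proof of the open sector theorem `X = ReducibleCrystallineModular` together with
  a refutation of the formal summit;
* (`¬ C → ¬ Langlands` is the landed `skinnerWilesDefectOne_not_langlands_of_not_sectorComplement`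
  pattern; here it is the `.2` of the previous lemma and is not restated);
* `eisensteinGelfandKirillov_not_langlands_of_not_target`: `¬ X → ¬ Langlands` — NEW for this route:
  the EGK sector is contained in the summit AS TYPED (direction (B) at `n = 2`, `ℓ = p`, reciprocity
  data from the summit's non-vacuity conjunct, crystalline for Fontaine's pinned datum ⇒ de Rham for
  `𝓡.pst` by `IsCrystallineFramed.isDeRhamFramed`), so a counterexample to Fontaine–Mazur in the
  sector would refute `Langlands` itself, and the load-bearing hypothesis `X` of the frame costs
  exactly `X` (dropping it turns the frame into the summit). The analogous containment is NOT
  derivable for the sibling ordinary sector (`Theorems/SkinnerWilesDefectOneSectorComplement.lean`,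
  module docstring), because "ordinary ⇒ de Rham" is not an axiom of the abstract datum;
* `eisensteinGelfandKirillov_sectorComplement_iff_not_or`: truth table `C ↔ ¬ X ∨ Langlands`.

Work file with the full analysis: `Cruxes/SectorComplement/Disproof.lean` (item stmt-Langlands-18275).
-/

set_option linter.dupNamespace false -- project-wide option; `Summit.Langlands.Langlands` is the mandated namespace

namespace Summit.Langlands.Langlands.Theorems

open Summit.Langlands.Langlands.Theses.EisensteinGelfandKirillov

/-- Exact content of a refutation of the frame: `¬ SectorComplement ↔ ReducibleCrystallineModular ∧
¬ Langlands` — prove the open sector theorem AND disprove the formal summit. [folklore] -/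
theorem eisensteinGelfandKirillov_not_sectorComplement_iff :
    ¬ SectorComplement ↔ ReducibleCrystallineModular ∧ ¬ _root_.Langlands :=
  Classical.not_imp

/-- **A counterexample to the sector theorem refutes the summit as typed**: `¬ X → ¬ Langlands`.
Contrapositive of the containment `Langlands → ReducibleCrystallineModular`: direction (B) of the
summit at `n = 2`, `ℓ = p`, for the reciprocity data `𝓡` given by the summit's conjunct
`Nonempty (ReciprocityData F)`; the sector's hypothesis "crystalline at `v ∣ p` for Fontaine's
pinned datum `fontainePstAdicCompletion v p hv`" yields "de Rham for `𝓡.pst p v hv`" since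
`ReciprocityData.pst` is by definition the pinned datum and crystalline ⇒ de Rham
(`PstWeilDeligneData.IsCrystallineFramed.isDeRhamFramed`); `Corresponds` contains the sector's
a.e. Satake–Frobenius clause verbatim. [folklore] -/
theorem eisensteinGelfandKirillov_not_langlands_of_not_target
    (hX : ¬ ReducibleCrystallineModular) : ¬ _root_.Langlands := by
  intro hL
  apply hX
  intro F _ _ _hF p _ _hp _hdisc O _hO hcpt ι ρ ρ₀ hirr _hodd hur _hup hloc
  obtain ⟨⟨𝓡⟩, h⟩ := hL F
  have hB : Summit.Langlands.GaloisToAutomorphic 2 𝓡 hcpt := (h 𝓡 2 two_pos hcpt).2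
  have hgeo : Summit.Langlands.IsGeometricFramed 𝓡 ρ :=
    ⟨hur, fun v hv ↦ (hloc v hv).2.1.isDeRhamFramed⟩
  obtain ⟨π, hLalg, hcorr⟩ := hB p ι ρ hirr hgeo
  exact ⟨π, hLalg, hcorr.1⟩

/-- Truth table of the frame: `SectorComplement ↔ ¬ ReducibleCrystallineModular ∨ Langlands` —
provable only by proving the summit or refuting the target, refutable only in the world "target
true, summit false". [folklore] -/
theorem eisensteinGelfandKirillov_sectorComplement_iff_not_or :
    SectorComplement ↔ ¬ ReducibleCrystallineModular ∨ _root_.Langlands :=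
  imp_iff_not_or

end Summit.Langlands.Langlands.Theorems
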